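import Mathlib
import Summits.ValiantsHypothesis.ValiantsHypothesis.Theorems.RigidityForcesSymmetryRankRigidMinimalReprLaplaceDefs
import Summits.ValiantsHypothesis.ValiantsHypothesis.Theorems.RigidityForcesSymmetryRankRigidMinimalReprLaplaceFourDefs
import Summits.ValiantsHypothesis.ValiantsHypothesis.Theorems.RigidityForcesSymmetryRankRigidMinimalReprLaplaceFourContraction
import Summits.ValiantsHypothesis.ValiantsHypothesis.Theorems.RigidityForcesSymmetryRankRigidMinimalReprLaplaceFourEasy

/-!
# A cheap split-rank-one decomposition of `P₄` has at most one slice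
# (crux `RankRigidMinimalRepr`, stmt-ValiantsHypothesis-18034, route `RigidityForcesSymmetry`)

THEOREM E of the exact analysis of `LaplaceOptimal 4` (`…LaplaceDefs.lean`): in the data format of `LaplaceOptimal 4`
— a finite family of split-rank-one terms `u_t(v|_{S_t}) w_t(v|_{S_tᶜ})` summing to `[v injective]` — if the Laplace
weight `Σ_t |S_t|!(4-|S_t|)!` is `< 24` then at most ONE term is a slice (`|S_t| ∈ {1,3}`):
`laplace_four_at_most_one_slice`.  Equivalently, the ten cheap profiles with two or three slices are impossible.

Proof.  Classify each term by its TYPE `τ ∈ Fin 7` (slice at slot `0..3`, or pair on the matching containing `{0,j}`,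
`j = 1,2,3`; `classify`), so the family has a profile `n : Fin 7 → ℕ` with `6·(slices) + 4·(pairs) < 24`.  A finite
search (`orient`, by `decide`: all profiles with ≥ 2 slices and all `24` slot relabellings) finds a relabelling `σ` after
which no slice sits at slot `1` and the counts of noise terms (slice at `0`, pair on `01|23`) and rank-one terms fit
`easy_profile` (`…LaplaceFourEasy.lean`); transporting the terms along `σ` (`…LaplaceFourContraction.lean`) finishes.
The three small `def`s (`rep`, `pairType`, `act`) only encode this finite search.

HONEST FRAMING: a finite tensor statement toward `LaplaceOptimal 4` (rung `TiedTorusBound 3` of the line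
`PairTiedTorusBound`); the crux stays OPEN and target-calibrated; census-neutral; nothing here bears on `VP ≠ VNP`.
-/

set_option autoImplicit false

-- the mandated summit-side namespace repeats a component by design (single-problem summit)
set_option linter.dupNamespace false

namespace Summit.ValiantsHypothesis.ValiantsHypothesis.Theorems.RigidityForcesSymmetryRankRigidMinimalRepr

namespace LaplaceFourSlices

open Matrix LaplaceFourContraction LaplaceFourEasy

/-! ### §1 Types of split terms and the finite search -/

/-- Canonical dependence sets of the seven types: slices at slots `0,1,2,3` and pairs `{0,j}`, `j = 1,2,3`. -/
def rep : Fin 7 → Finset (Fin 4) := ![{0}, {1}, {2}, {3}, {0, 1}, {0, 2}, {0, 3}]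

/-- The type (in `Fin 7`) of the pair on the matching `{c,d | rest}`, `c ≠ d` (junk on the diagonal). -/
def pairType (c d : Fin 4) : Fin 7 := ![![4, 4, 5, 6], ![4, 4, 6, 5], ![5, 6, 4, 4], ![6, 5, 4, 4]] c d

/-- The action of a slot relabelling `σ` on types (`rep_map`). -/
def act (σ : Equiv.Perm (Fin 4)) (τ : Fin 7) : Fin 7 :=
  if h : (τ : ℕ) < 4 then Fin.castLE (by norm_num) (σ ⟨τ, h⟩)
  else pairType (σ 0) (σ ⟨(τ : ℕ) - 3, by omega⟩)

/-- Every admissible dependence set is a canonical one or its complement. -/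
theorem classify : ∀ A : Finset (Fin 4), (A.card = 1 ∨ A.card = 2 ∨ A.card = 3) →
    ∃ τ : Fin 7, A = rep τ ∨ Aᶜ = rep τ := by
  decide +kernel

/-- The Laplace weight of a term of type `τ`: `6` for slices, `4` for pairs. -/
theorem weight_of_type : ∀ (A : Finset (Fin 4)) (τ : Fin 7), (A = rep τ ∨ Aᶜ = rep τ) →
    A.card.factorial * (4 - A.card).factorial = if (τ : ℕ) < 4 then 6 else 4 := by
  decide +kernel

/-- A dependence set of Laplace weight `< 24` has `1`, `2` or `3` elements. -/
theorem card_of_weight_lt : ∀ A : Finset (Fin 4), A.card.factorial * (4 - A.card).factorial < 24 →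
    (A.card = 1 ∨ A.card = 2 ∨ A.card = 3) := by
  decide +kernel

/-- Relabelling a canonical set gives the canonical set of the transported type, or its complement. -/
theorem rep_map : ∀ (σ : Equiv.Perm (Fin 4)) (τ : Fin 7),
    (rep τ).map σ.toEmbedding = rep (act σ τ) ∨ ((rep τ).map σ.toEmbedding)ᶜ = rep (act σ τ) := by
  decide +kernel

/-- The canonical sets other than `{1}` are those allowed by `easy_profile`. -/
theorem rep_cases : ∀ τ : Fin 7, τ ≠ 1 →
    (rep τ = {0} ∨ rep τ = {0, 1} ∨ rep τ = {2} ∨ rep τ = {3} ∨ rep τ = {0, 2} ∨ rep τ = {0, 3}) := by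
  decide +kernel

/-- Noise types in canonical position: slice at `0` (`τ = 0`) or pair on `01|23` (`τ = 4`). -/
theorem rep_noise_iff : ∀ τ : Fin 7, (rep τ = {0} ∨ rep τ = {0, 1}) ↔ (τ = 0 ∨ τ = 4) := by
  decide +kernel

/-- THE FINITE SEARCH.  For every profile `n : Fin 7 → {0,…,3}` of weight `< 24` with at least two slices there is a
relabelling `σ` with no slice at the new slot `1` and with (noise, rank-one) counts `(≤ 2, ≤ 2)` or `(≤ 3, ≤ 1)`. -/
theorem orient : ∀ n : Fin 7 → Fin 4,
    6 * ((n 0 : ℕ) + n 1 + n 2 + n 3) + 4 * ((n 4 : ℕ) + n 5 + n 6) < 24 →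
    2 ≤ (n 0 : ℕ) + n 1 + n 2 + n 3 →
    ∃ σ : Equiv.Perm (Fin 4), (∀ τ, act σ τ = 1 → n τ = 0) ∧
      (((∑ τ : Fin 7, if act σ τ = 0 ∨ act σ τ = 4 then (n τ : ℕ) else 0) ≤ 2 ∧
          (∑ τ : Fin 7, if act σ τ = 0 ∨ act σ τ = 4 then 0 else (n τ : ℕ)) ≤ 2) ∨
        ((∑ τ : Fin 7, if act σ τ = 0 ∨ act σ τ = 4 then (n τ : ℕ) else 0) ≤ 3 ∧
          (∑ τ : Fin 7, if act σ τ = 0 ∨ act σ τ = 4 then 0 else (n τ : ℕ)) ≤ 1)) := by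
  decide +kernel


/-- Slices are the types `< 4`. -/
theorem type_lt_four : ∀ (A : Finset (Fin 4)) (τ : Fin 7), (A = rep τ ∨ Aᶜ = rep τ) →
    (A.card = 1 ∨ A.card = 3) → (τ : ℕ) < 4 := by
  decide +kernel

/-! ### §2 Theorem E -/

/-- **A cheap split-rank-one decomposition of `P₄` has at most one slice.**  In the data format of `LaplaceOptimal 4`:
if split-rank-one terms `u_t(v|_{S_t}) · w_t(v|_{S_tᶜ})`, `t ∈ T`, sum to the pattern `[v injective]` on `Fin 4 → Fin 4`
with total Laplace weight `Σ_t |S_t|!(4-|S_t|)! < 24`, then no two distinct terms are slices (`|S_t| ∈ {1,3}`). -/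
theorem laplace_four_at_most_one_slice {N : ℕ} (T : Finset (Fin N)) (S : Fin N → Finset (Fin 4))
    (u w : Fin N → (Fin 4 → Fin 4) → ℂ)
    (hu : ∀ t, ∀ v v' : Fin 4 → Fin 4, (∀ i ∈ S t, v i = v' i) → u t v = u t v')
    (hw : ∀ t, ∀ v v' : Fin 4 → Fin 4, (∀ i, i ∉ S t → v i = v' i) → w t v = w t v')
    (hsum : ∀ v : Fin 4 → Fin 4, (∑ t ∈ T, u t v * w t v) = if Function.Injective v then 1 else 0)
    (hlt : ∑ t ∈ T, (S t).card.factorial * (4 - (S t).card).factorial < 24)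
    {t₁ t₂ : Fin N} (h₁ : t₁ ∈ T) (h₂ : t₂ ∈ T) (hne : t₁ ≠ t₂)
    (hs₁ : (S t₁).card = 1 ∨ (S t₁).card = 3) (hs₂ : (S t₂).card = 1 ∨ (S t₂).card = 3) : False := by
  classical
  -- every term has an admissible dependence set, hence a type
  have hcard : ∀ t ∈ T, (S t).card = 1 ∨ (S t).card = 2 ∨ (S t).card = 3 := fun t ht =>
    card_of_weight_lt _ ((Finset.single_le_sum (f := fun t => (S t).card.factorial * (4 - (S t).card).factorial)
      (fun _ _ => Nat.zero_le _) ht).trans_lt hlt)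
  have hcl : ∀ t, ∃ τ : Fin 7, t ∈ T → (S t = rep τ ∨ (S t)ᶜ = rep τ) := fun t => by
    by_cases ht : t ∈ T
    · obtain ⟨τ, hτ⟩ := classify (S t) (hcard t ht); exact ⟨τ, fun _ => hτ⟩
    · exact ⟨0, fun h => absurd h ht⟩
  choose ty hty using hcl
  -- the profile
  set n : Fin 7 → ℕ := fun τ => (T.filter fun t => ty t = τ).card with hn
  have hfib : ∀ (P : Fin 7 → Prop) [DecidablePred P],
      (T.filter fun t => P (ty t)).card = ∑ τ, if P τ then n τ else 0 := by
    intro P _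
    rw [Finset.card_eq_sum_card_fiberwise (f := ty) (t := Finset.univ) (fun _ _ => Finset.mem_univ _)]
    refine Finset.sum_congr rfl fun τ _ => ?_
    split_ifs with hP
    · rw [hn]; congr 1; ext t; simp only [Finset.mem_filter]; constructor
      · rintro ⟨⟨ht, -⟩, rfl⟩; exact ⟨ht, rfl⟩
      · rintro ⟨ht, rfl⟩; exact ⟨⟨ht, hP⟩, rfl⟩
    · rw [Finset.card_eq_zero, Finset.filter_eq_empty_iff]
      rintro t ht
      rw [Finset.mem_filter] at ht
      rintro rfl; exact hP ht.2
  -- the weight in terms of the profile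
  have hW : ∑ t ∈ T, (S t).card.factorial * (4 - (S t).card).factorial =
      ∑ τ, n τ * (if (τ : ℕ) < 4 then 6 else 4) := by
    rw [← Finset.sum_fiberwise_of_maps_to (s := T) (t := Finset.univ) (g := ty) (fun _ _ => Finset.mem_univ _)]
    refine Finset.sum_congr rfl fun τ _ => ?_
    rw [Finset.sum_congr rfl fun t ht => ?_, Finset.sum_const, smul_eq_mul]
    rw [Finset.mem_filter] at ht
    rw [weight_of_type (S t) (ty t) (hty t ht.1), ht.2]
  have hW' : ∑ τ, n τ * (if (τ : ℕ) < 4 then 6 else 4) = 6 * (n 0 + n 1 + n 2 + n 3) + 4 * (n 4 + n 5 + n 6) := by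
    simp [Fin.sum_univ_seven]; ring
  -- at least two slices
  have hsl : 2 ≤ n 0 + n 1 + n 2 + n 3 := by
    have h2 : 2 ≤ (T.filter fun t => (ty t : ℕ) < 4).card := by
      rw [← Finset.card_pair hne]
      refine Finset.card_le_card ?_
      intro t ht
      simp only [Finset.mem_insert, Finset.mem_singleton] at ht
      rw [Finset.mem_filter]
      rcases ht with rfl | rfl
      · exact ⟨h₁, type_lt_four _ _ (hty _ h₁) hs₁⟩
      · exact ⟨h₂, type_lt_four _ _ (hty _ h₂) hs₂⟩
    rw [hfib (fun τ => (τ : ℕ) < 4)] at h2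
    simpa [Fin.sum_univ_seven] using h2
  have hlt' : 6 * (n 0 + n 1 + n 2 + n 3) + 4 * (n 4 + n 5 + n 6) < 24 := by rw [← hW', ← hW]; exact hlt
  have hbd : ∀ τ, n τ < 4 := fun τ => by fin_cases τ <;> simp <;> omega
  obtain ⟨σ, hσ1, hσ2⟩ := orient (fun τ => ⟨n τ, hbd τ⟩) (by simpa using hlt') (by simpa using hsl)
  simp only [Fin.isValue] at hσ1 hσ2
  -- transport along `σ` into the format of `easy_profile`
  have hterm : ∀ t ∈ T, IsSplitTerm (rep (ty t)) (fun v => u t v * w t v) := by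
    intro t ht
    have h0 : IsSplitTerm (S t) (fun v => u t v * w t v) :=
      ⟨u t, w t, hu t, fun v v' h => hw t v v' fun i hi => h i (Finset.mem_compl.2 hi), fun _ => rfl⟩
    rcases hty t ht with h | h
    · rw [← h]; exact h0
    · rw [← h]; exact isSplitTerm_compl h0
  have hterm' : ∀ t ∈ T, IsSplitTerm (rep (act σ (ty t))) (slotPerm σ fun v => u t v * w t v) := by
    intro t ht
    have h1 := isSplitTerm_slotPerm σ (hterm t ht)
    rcases rep_map σ (ty t) with h | h
    · rw [← h]; exact h1
    · rw [← h]; exact isSplitTerm_compl h1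
  have hne1 : ∀ t ∈ T, act σ (ty t) ≠ 1 := by
    intro t ht h1
    have := hσ1 (ty t) h1
    have hpos : 0 < n (ty t) := Finset.card_pos.2 ⟨t, Finset.mem_filter.2 ⟨ht, rfl⟩⟩
    simp only [Fin.ext_iff, Fin.val_zero] at this
    omega
  have hsum' : ∀ v, permPattern₄ v = ∑ t ∈ T, slotPerm σ (fun v => u t v * w t v) v := by
    intro v
    have := congrFun (slotPerm_permPattern σ) v
    rw [← this]
    simp only [slotPerm, permPattern₄, ← hsum]
  refine easy_profile T (fun t => slotPerm σ fun v => u t v * w t v) (fun t => rep (act σ (ty t))) hterm'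
    (fun t ht => rep_cases _ (hne1 t ht)) hsum' ?_
  -- the counts
  have hN : (T.filter fun t => rep (act σ (ty t)) = {0} ∨ rep (act σ (ty t)) = {0, 1}).card =
      ∑ τ, if (act σ τ = 0 ∨ act σ τ = 4) then n τ else 0 := by
    rw [← hfib (fun τ => act σ τ = 0 ∨ act σ τ = 4)]
    congr 1; ext t; simp only [Finset.mem_filter, rep_noise_iff]
  have hR : (T.filter fun t => ¬(rep (act σ (ty t)) = {0} ∨ rep (act σ (ty t)) = {0, 1})).card =
      ∑ τ, if (act σ τ = 0 ∨ act σ τ = 4) then 0 else n τ := by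
    rw [show (∑ τ, if (act σ τ = 0 ∨ act σ τ = 4) then 0 else n τ) =
        ∑ τ, if ¬(act σ τ = 0 ∨ act σ τ = 4) then n τ else 0 from
      Finset.sum_congr rfl fun τ _ => by split_ifs <;> simp_all]
    rw [← hfib (fun τ => ¬(act σ τ = 0 ∨ act σ τ = 4))]
    congr 1; ext t; simp only [Finset.mem_filter, rep_noise_iff]
  rw [hN, hR]
  simpa using hσ2

end LaplaceFourSlices

end Summit.ValiantsHypothesis.ValiantsHypothesis.Theorems.RigidityForcesSymmetryRankRigidMinimalRepr
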